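import Mathlib
import Summits.PneNP.PneNP.Theorems.ConvexRankGatesConvexGateBlindExactLiftingTriangleFixedShift

/-!
# PneNP / ConvexRankGates — `ConvexGateBlind`, line `xor-door-perfect-completeness`:
# Theorem A in the ANCHORED (strict-rank) currency (prover seat 0, session 21)

Helper toward crux item stmt-PneNP-10680 (`--supports`; open stub `stub_exactLifting`, whose ε-free form is the
ANCHORED lifting statement, seat 3's registered `exactLifting_iff_anchored`).  Memo ANALYSIS11.

Hrubeš's strict non-negative rank counts factorisations `M = Σ_{l<R} u_l ⊗ v_l + A ⊗ B` with a strictly positive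
anchor `A, B > 0`.  If the anchor is bounded below, `A ≥ α > 0`, `B ≥ β > 0`, then
`A ⊗ B − αβ·J = (A − α) ⊗ B + α ⊗ (B − β)` is a sum of two non-negative rank-one terms, so the anchored factorisation is a
non-negative factorisation of `M − αβ·J` with `R + 2` terms and the fixed-shift bound applies at `ε = αβ`:

* `anchored_fixed_shift_bound` (registered sub-goal `triangle_anchored_shift_bound`): for the triangle matrix `M_t`,
  `t ≥ 3`, `0 < αβ ≤ 1`:  `(αβ)^{11} · t³ ≤ 10^{19} · (ln t)⁴ · (R + 2)`.

Reading: a strict factorisation of `M_t` with `O(t²)` terms must have a DEGENERATING anchor, `min A · min B → 0`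
(quantitatively `≤ (K ln⁴t / t)^{1/11}`); the line model (ANALYSIS10, `triangle_anchored_line_bound`) excludes line-supported
ones for every anchor.  Elementary; no definitions.
-/

set_option linter.dupNamespace false -- `Summit.PneNP.PneNP.…`: summit = sub-problem (D-0017)

namespace Summit.PneNP.PneNP.Theorems.XorDoor.TriLine

open scoped BigOperators
open Finset Real

noncomputable section

variable {t : ℕ}

/-- **Theorem A, anchored form.** For `t ≥ 3`, an anchored non-negative factorisation
`M_t = Σ_{l<R} u_l ⊗ v_l + A ⊗ B` with `A ≥ α > 0`, `B ≥ β > 0`, `αβ ≤ 1` has `(αβ)^{11} t³ ≤ 10^{19} (ln t)⁴ (R + 2)`. -/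
theorem anchored_fixed_shift_bound {R : ℕ} (ht : 3 ≤ t) {α β : ℝ} (hα : 0 < α) (hβ : 0 < β) (hαβ : α * β ≤ 1)
    {u : Col t → Fin R → ℝ} {v : Fin R → Tri t → ℝ} {A : Col t → ℝ} {B : Tri t → ℝ}
    (hu : ∀ x l, 0 ≤ u x l) (hv : ∀ l w, 0 ≤ v l w) (hA : ∀ x, α ≤ A x) (hB : ∀ w, β ≤ B w)
    (hfact : ∀ x w, (monoCount x w : ℝ) = ∑ l, u x l * v l w + A x * B w) :
    (α * β) ^ 11 * (t : ℝ) ^ 3 ≤ 10 ^ 19 * Real.log t ^ 4 * (R + 2 : ℕ) := by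
  -- the factorisation of `M_t − αβ` with `R + 2` terms
  let u' : Col t → Fin (R + 2) → ℝ := fun x => Fin.addCases (fun l => u x l) (fun j => if j = 0 then A x - α else α)
  let v' : Fin (R + 2) → Tri t → ℝ := Fin.addCases (fun l w => v l w) (fun j w => if j = 0 then B w else B w - β)
  have hu' : ∀ x l, 0 ≤ u' x l := by
    intro x l
    refine Fin.addCases (fun l => ?_) (fun j => ?_) l
    · simp only [u', Fin.addCases_left]; exact hu x l
    · simp only [u', Fin.addCases_right]
      split_ifs
      · linarith [hA x]
      · exact hα.le
  have hv' : ∀ l w, 0 ≤ v' l w := by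
    intro l w
    refine Fin.addCases (fun l => ?_) (fun j => ?_) l
    · simp only [v', Fin.addCases_left]; exact hv l w
    · simp only [v', Fin.addCases_right]
      split_ifs
      · linarith [hB w]
      · linarith [hB w]
  have hfact' : ∀ x w, (monoCount x w : ℝ) - α * β = ∑ l, u' x l * v' l w := by
    intro x w
    rw [Fin.sum_univ_add, Fin.sum_univ_two]
    simp only [u', v', Fin.addCases_left, Fin.addCases_right, Fin.isValue, if_true, one_ne_zero, if_false]
    rw [hfact x w]
    ring
  exact fixed_shift_bound ht (mul_pos hα hβ) hαβ hu' hv' hfact'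

/-- **Theorem A, anchored form** (registered sub-goal `triangle_anchored_shift_bound` of stmt-PneNP-10680, explicit
vocabulary): an anchored factorisation of the triangle matrix with anchor bounded below by `α ⊗ β` has
`(αβ)^{11} t³ ≤ 10^{19} (ln t)⁴ (R + 2)`. -/
theorem triangle_anchored_shift_bound :
    ∀ (t R : ℕ), 3 ≤ t → ∀ (α β : ℝ), 0 < α → 0 < β → α * β ≤ 1 →
    ∀ (u : (Fin t → Bool) × (Fin t → Bool) × (Fin t → Bool) → Fin R → ℝ) (v : Fin R → Fin t × Fin t × Fin t → ℝ)
      (A : (Fin t → Bool) × (Fin t → Bool) × (Fin t → Bool) → ℝ) (B : Fin t × Fin t × Fin t → ℝ),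
    (∀ x l, 0 ≤ u x l) → (∀ l w, 0 ≤ v l w) → (∀ x, α ≤ A x) → (∀ w, β ≤ B w) →
    (∀ x w, (((if x.1 w.1 = x.2.1 w.2.1 then 1 else 0) + (if x.1 w.1 = x.2.2 w.2.2 then 1 else 0) +
      (if x.2.1 w.2.1 = x.2.2 w.2.2 then 1 else 0) : ℕ) : ℝ) = ∑ l, u x l * v l w + A x * B w) →
    (α * β) ^ 11 * (t : ℝ) ^ 3 ≤ 10 ^ 19 * Real.log t ^ 4 * (R + 2 : ℕ) :=
  fun _ _ ht _ _ hα hβ hαβ _ _ _ _ hu hv hA hB hfact =>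
    anchored_fixed_shift_bound ht hα hβ hαβ hu hv hA hB (fun x w => by simpa [monoCount] using hfact x w)

end

end Summit.PneNP.PneNP.Theorems.XorDoor.TriLine
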